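import Literature.NumberTheory.Sieve.MaynardTao
import Mathlib.Analysis.SpecialFunctions.Integrals.Basic
import Mathlib.MeasureTheory.Integral.Prod
import HarnessLib

/-!
# Dirichlet's simplex integrals (Maynard 2015, Lemma 7.1)

J. Maynard, *Small gaps between primes*, Ann. of Math. (2) 181 (2015), 383–413 = arXiv:1311.4600,
§7, Lemma 7.1 and its proof, display (7.4): for the corner simplex
`R_k = {t ∈ [0,1]^k : ∑ tᵢ ≤ 1}` (`Literature.maynardSimplex k`) and natural exponents `a, c₁, …, c_k`,

  `∫_{R_k} (1 − ∑ᵢ tᵢ)^a ∏ᵢ tᵢ^{cᵢ} dt = a! ∏ᵢ cᵢ! / (k + a + ∑ᵢ cᵢ)!`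

(Dirichlet's integral), proved as in print by induction on `k`: integrate out the first coordinate
with the substitution `t₁ = (1 − ∑_{i ≥ 2} tᵢ) v` and the Beta integral
`∫₀¹ v^m (1 − v)^n dv = m! n!/(m + n + 1)!`.  From it, the three moments of the power sum
`P₂ = ∑ tᵢ²` against `(1 − P₁)^a` that enter Maynard's Lemma 7.2 for polynomials of degree `≤ 2` in
`P₂` (the case of Proposition 4.3 (1), `k = 5`):

* `∫_{R_k} (1 − P₁)^a = a!/(k + a)!`,
* `∫_{R_k} (1 − P₁)^a P₂ = 2k · a!/(k + a + 2)!`       (`G_{1,2}(k) = 2k`),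
* `∫_{R_k} (1 − P₁)^a P₂² = (4k² + 20k) · a!/(k + a + 4)!`  (`G_{2,2}(k) = 24k + 4k(k−1)`).

Main results: `Literature.NumberTheory.Sieve.MaynardTao.integral_pow_mul_one_sub_pow` (Beta),
`Literature.NumberTheory.Sieve.MaynardTao.lintegral_simplex_dirichlet` / `Literature.NumberTheory.Sieve.MaynardTao.setIntegral_simplex_dirichlet`
(Dirichlet's formula, `ℝ≥0∞` and Bochner forms), `Literature.NumberTheory.Sieve.MaynardTao.setIntegral_simplex_oneSubPow`,
`…_mul_powSumTwo`, `…_mul_powSumTwo_sq` (the three moments).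

Implementation: the coordinate `t₀` is split off with the volume-preserving
`MeasurableEquiv.piFinSuccAbove (fun _ ↦ ℝ) 0` (`e.symm (x, s) = Fin.cons x s`), the fibres are
reassembled by Tonelli (`MeasureTheory.lintegral_prod_symm`) in `ℝ≥0∞` (the integrand is nonnegative
on `R_k`), and the result is transported to the Bochner set integral at the end.

## References

* J. Maynard, *Small gaps between primes*, Ann. of Math. (2) 181 (2015), 383–413,
  doi:10.4007/annals.2015.181.1.7 = arXiv:1311.4600, §7, Lemma 7.1 and (7.4)–(7.6).
  [cite: MaynardAnnals2015]
-/

noncomputable section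

open MeasureTheory Set Filter intervalIntegral
open scoped ENNReal Nat

namespace Literature.NumberTheory.Sieve

namespace MaynardTao

/-! ### The Beta integral at natural arguments -/

/-- **Euler's Beta integral at natural arguments**: `∫₀¹ v^m (1 − v)^n dv = m! n!/(m + n + 1)!`
(the "beta function identity" used in the proof of Maynard's Lemma 7.1). Proof by induction on `n`:
`∫₀¹ d/dv (v^{m+1} (1 − v)^{n+1}) dv = 0` gives `(m+1) I(m, n+1) = (n+1) I(m+1, n)`.
[cite: MaynardAnnals2015, proof of Lemma 7.1 (beta function identity)] -/
theorem integral_pow_mul_one_sub_pow (m n : ℕ) :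
    ∫ v in (0:ℝ)..1, v ^ m * (1 - v) ^ n = (m ! * n ! : ℝ) / (m + n + 1)! := by
  induction n generalizing m with
  | zero =>
    have hm : ((m + 0 + 1)! : ℝ) = (m + 1) * m ! := by
      rw [add_zero, Nat.factorial_succ]; push_cast; ring
    simp only [pow_zero, mul_one, integral_pow, one_pow, ne_eq, Nat.add_eq_zero_iff, one_ne_zero,
      and_false, not_false_eq_true, zero_pow, sub_zero, Nat.factorial_zero, Nat.cast_one, hm]
    have : (m ! : ℝ) ≠ 0 := by positivity
    field_simp
  | succ n ih =>
    -- `(m+1) I(m, n+1) = (n+1) I(m+1, n)` from the fundamental theorem of calculus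
    have hderiv : ∀ v ∈ Set.uIcc (0:ℝ) 1,
        HasDerivAt (fun v : ℝ => v ^ (m + 1) * (1 - v) ^ (n + 1))
          (((m:ℝ) + 1) * (v ^ m * (1 - v) ^ (n + 1)) -
            ((n:ℝ) + 1) * (v ^ (m + 1) * (1 - v) ^ n)) v := by
      intro v _
      have ha : HasDerivAt (fun v : ℝ => v ^ (m + 1)) (((m + 1 : ℕ) : ℝ) * v ^ m) v := by
        simpa using hasDerivAt_pow (m + 1) v
      have hb : HasDerivAt (fun v : ℝ => (1 - v) ^ (n + 1))
          (((n + 1 : ℕ) : ℝ) * (1 - v) ^ (n + 1 - 1) * (-1)) v :=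
        (hasDerivAt_pow (n + 1) (1 - v)).comp v ((hasDerivAt_id v).const_sub 1)
      refine (ha.mul hb).congr_deriv ?_
      rw [Nat.add_sub_cancel]
      push_cast
      ring
    have hFTC := intervalIntegral.integral_eq_sub_of_hasDerivAt hderiv
      ((by fun_prop : Continuous fun v : ℝ => ((m:ℝ) + 1) * (v ^ m * (1 - v) ^ (n + 1)) -
        ((n:ℝ) + 1) * (v ^ (m + 1) * (1 - v) ^ n)).intervalIntegrable 0 1)
    have hzero : (1:ℝ) ^ (m + 1) * (1 - 1) ^ (n + 1) - 0 ^ (m + 1) * (1 - 0) ^ (n + 1) = 0 := by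
      simp
    rw [hzero, intervalIntegral.integral_sub
        ((by fun_prop : Continuous fun v : ℝ => ((m:ℝ) + 1) * (v ^ m * (1 - v) ^ (n + 1)))
          |>.intervalIntegrable 0 1)
        ((by fun_prop : Continuous fun v : ℝ => ((n:ℝ) + 1) * (v ^ (m + 1) * (1 - v) ^ n))
          |>.intervalIntegrable 0 1),
      intervalIntegral.integral_const_mul, intervalIntegral.integral_const_mul, sub_eq_zero] at hFTC
    -- combine with the induction hypothesis at `m + 1`
    have hB := ih (m + 1)
    have hm0 : ((m:ℝ) + 1) ≠ 0 := by positivity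
    have key : ∫ v in (0:ℝ)..1, v ^ m * (1 - v) ^ (n + 1) =
        ((n:ℝ) + 1) / ((m:ℝ) + 1) * ∫ v in (0:ℝ)..1, v ^ (m + 1) * (1 - v) ^ n := by
      field_simp
      linarith
    rw [key, hB, show m + 1 + n + 1 = m + (n + 1) + 1 by ring, Nat.factorial_succ (m),
      Nat.factorial_succ n]
    push_cast
    have h1 : ((m + (n + 1) + 1)! : ℝ) ≠ 0 := by positivity
    field_simp

/-- The scaled Beta integral: for `S ≥ 0`, `∫₀^S (S − x)^a x^c dx = S^{a+c+1} · c! a!/(c + a + 1)!`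
(substitute `x = S v`). [cite: MaynardAnnals2015, proof of Lemma 7.1, display (7.5)] -/
theorem integral_Icc_sub_pow_mul_pow {S : ℝ} (hS : 0 ≤ S) (a c : ℕ) :
    ∫ x in Icc 0 S, (S - x) ^ a * x ^ c = S ^ (a + c + 1) * ((c ! * a ! : ℝ) / (c + a + 1)!) := by
  rw [integral_Icc_eq_integral_Ioc, ← intervalIntegral.integral_of_le hS]
  have hsub : ∫ x in (0:ℝ)..S, (S - x) ^ a * x ^ c =
      S • ∫ v in (0:ℝ)..1, (S - S * v) ^ a * (S * v) ^ c := by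
    rw [intervalIntegral.smul_integral_comp_mul_left (f := fun x => (S - x) ^ a * x ^ c) S,
      mul_zero, mul_one]
  rw [hsub, smul_eq_mul]
  have hfun : (fun v : ℝ => (S - S * v) ^ a * (S * v) ^ c) =
      fun v => S ^ (a + c) * (v ^ c * (1 - v) ^ a) := by
    ext v
    rw [show S - S * v = S * (1 - v) by ring, mul_pow, mul_pow, pow_add]
    ring
  rw [hfun, intervalIntegral.integral_const_mul, integral_pow_mul_one_sub_pow c a]
  ring

/-! ### Dirichlet's formula -/

/-- `R_0` is the whole (one-point) space. [folklore] -/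
theorem maynardSimplex_zero : maynardSimplex 0 = Set.univ := by
  ext t
  simp [maynardSimplex]

/-- Membership of `Fin.cons x s` in `R_{k+1}`: `s ∈ R_k`, `0 ≤ x` and `x + ∑ sᵢ ≤ 1`. [folklore] -/
theorem cons_mem_maynardSimplex_iff {k : ℕ} (x : ℝ) (s : Fin k → ℝ) :
    (Fin.cons x s : Fin (k + 1) → ℝ) ∈ maynardSimplex (k + 1) ↔
      s ∈ maynardSimplex k ∧ 0 ≤ x ∧ x + ∑ i, s i ≤ 1 := by
  simp only [maynardSimplex, Set.mem_setOf_eq, Fin.forall_fin_succ, Fin.cons_zero, Fin.cons_succ,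
    Fin.sum_univ_succ]
  constructor
  · rintro ⟨⟨hx, hs⟩, hsum⟩
    exact ⟨⟨hs, by linarith⟩, hx, hsum⟩
  · rintro ⟨⟨hs, -⟩, hx, hsum⟩
    exact ⟨⟨hx, hs⟩, hsum⟩

/-- The Dirichlet integrand `(1 − ∑ tᵢ)^a ∏ tᵢ^{cᵢ}` is nonnegative on `R_k`. [folklore] -/
theorem dirichlet_integrand_nonneg {k : ℕ} (a : ℕ) (c : Fin k → ℕ) {t : Fin k → ℝ}
    (ht : t ∈ maynardSimplex k) : 0 ≤ (1 - ∑ i, t i) ^ a * ∏ i, t i ^ c i :=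
  mul_nonneg (pow_nonneg (by linarith [ht.2]) a) (Finset.prod_nonneg fun i _ => pow_nonneg (ht.1 i) _)

/-- The one-dimensional fibre of Dirichlet's integral: for `s ∈ R_k` with `S = 1 − ∑ sᵢ`,
`∫ 1_{[0,S]}(x) (S − x)^a x^{c₀} K dx = K S^{a+c₀+1} c₀! a!/(a + c₀ + 1)!` in `ℝ≥0∞` (`K ≥ 0` a
constant). [cite: MaynardAnnals2015, proof of Lemma 7.1, display (7.5)] -/
theorem lintegral_fibre_dirichlet {S K : ℝ} (hS : 0 ≤ S) (hK : 0 ≤ K) (a c : ℕ) :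
    ∫⁻ x, (Icc 0 S).indicator (fun x => ENNReal.ofReal ((S - x) ^ a * x ^ c * K)) x =
      ENNReal.ofReal (K * (S ^ (a + c + 1) * ((c ! * a ! : ℝ) / (c + a + 1)!))) := by
  rw [lintegral_indicator measurableSet_Icc]
  have hint : IntegrableOn (fun x : ℝ => (S - x) ^ a * x ^ c * K) (Icc 0 S) :=
    (by fun_prop : Continuous fun x : ℝ => (S - x) ^ a * x ^ c * K).integrableOn_Icc
  have hnn : 0 ≤ᵐ[volume.restrict (Icc 0 S)] fun x : ℝ => (S - x) ^ a * x ^ c * K := by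
    refine ae_restrict_of_forall_mem measurableSet_Icc fun x hx => ?_
    exact mul_nonneg (mul_nonneg (pow_nonneg (by linarith [hx.2]) _) (pow_nonneg hx.1 _)) hK
  rw [← ofReal_integral_eq_lintegral_ofReal hint hnn]
  congr 1
  have : ∫ x in Icc 0 S, (S - x) ^ a * x ^ c * K = (∫ x in Icc 0 S, (S - x) ^ a * x ^ c) * K :=
    integral_mul_const K _
  rw [this, integral_Icc_sub_pow_mul_pow hS, mul_comm]

/-- **Dirichlet's integral over the simplex, `ℝ≥0∞` form** (Maynard 2015, proof of Lemma 7.1,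
(7.4)): `∫ 1_{R_k}(t) (1 − ∑ tᵢ)^a ∏ tᵢ^{cᵢ} dt = a! ∏ cᵢ! / (k + a + ∑ cᵢ)!`.  Induction on `k`,
splitting off `t₀` (`MeasurableEquiv.piFinSuccAbove _ 0`, Tonelli) and using
`lintegral_fibre_dirichlet`. [cite: MaynardAnnals2015, Lemma 7.1, display (7.4)] -/
theorem lintegral_simplex_dirichlet (k a : ℕ) (c : Fin k → ℕ) :
    ∫⁻ t, (maynardSimplex k).indicator
        (fun t => ENNReal.ofReal ((1 - ∑ i, t i) ^ a * ∏ i, t i ^ c i)) t =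
      ENNReal.ofReal ((a ! * ∏ i, ((c i)! : ℝ)) / (k + a + ∑ i, c i)!) := by
  induction k generalizing a with
  | zero =>
    rw [maynardSimplex_zero, Set.indicator_univ]
    simp only [Finset.univ_eq_empty, Finset.sum_empty, sub_zero, one_pow, Finset.prod_empty,
      mul_one, ENNReal.ofReal_one, lintegral_const, one_mul, zero_add, add_zero]
    rw [MeasureTheory.volume_pi, Measure.pi_empty_univ]
    have : (a ! : ℝ) ≠ 0 := by positivity
    rw [div_self this, ENNReal.ofReal_one]
  | succ k ih =>
    -- the integrand and its measurability
    set G : (Fin (k + 1) → ℝ) → ℝ≥0∞ := (maynardSimplex (k + 1)).indicator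
        (fun t => ENNReal.ofReal ((1 - ∑ i, t i) ^ a * ∏ i, t i ^ c i)) with hG
    have hGm : Measurable G := by
      refine Measurable.indicator ?_ (measurableSet_maynardSimplex _)
      exact (Continuous.measurable (by fun_prop)).ennreal_ofReal
    -- split off the coordinate `0`: `e.symm (x, s) = Fin.cons x s`
    set e := MeasurableEquiv.piFinSuccAbove (fun _ : Fin (k + 1) => ℝ) 0 with he_def
    have he : MeasurePreserving e.symm volume volume :=
      (volume_preserving_piFinSuccAbove (fun _ : Fin (k + 1) => ℝ) 0).symm
    have he_apply : ∀ p : ℝ × (Fin k → ℝ), e.symm p = Fin.cons p.1 p.2 := fun p => by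
      rw [he_def, MeasurableEquiv.piFinSuccAbove_symm_apply]
      exact Fin.insertNth_zero' _ _
    -- the constant `B = c₀! a!/(c₀ + a + 1)!` of the fibre integral
    set B : ℝ := ((c 0)! * a ! : ℝ) / (c 0 + a + 1)! with hB
    have hB0 : 0 ≤ B := by positivity
    -- the fibres
    have hfibre : ∀ s : Fin k → ℝ, ∫⁻ x, G (e.symm (x, s)) =
        (maynardSimplex k).indicator (fun s => ENNReal.ofReal
          (B * ((1 - ∑ i, s i) ^ (a + c 0 + 1) * ∏ i, s i ^ c (Fin.succ i)))) s := by
      intro s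
      by_cases hs : s ∈ maynardSimplex k
      · rw [Set.indicator_of_mem hs]
        have hS : 0 ≤ 1 - ∑ i, s i := by linarith [hs.2]
        have hK : 0 ≤ ∏ i, s i ^ c (Fin.succ i) :=
          Finset.prod_nonneg fun i _ => pow_nonneg (hs.1 i) _
        have hGx : ∀ x, G (e.symm (x, s)) = (Icc 0 (1 - ∑ i, s i)).indicator
            (fun x => ENNReal.ofReal (((1 - ∑ i, s i) - x) ^ a * x ^ c 0 *
              ∏ i, s i ^ c (Fin.succ i))) x := by
          intro x
          rw [he_apply, hG]
          simp only
          by_cases hx : x ∈ Icc 0 (1 - ∑ i, s i)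
          · have hmem : (Fin.cons x s : Fin (k + 1) → ℝ) ∈ maynardSimplex (k + 1) :=
              (cons_mem_maynardSimplex_iff x s).2 ⟨hs, hx.1, by linarith [hx.2]⟩
            rw [Set.indicator_of_mem hmem, Set.indicator_of_mem hx, Fin.sum_univ_succ,
              Fin.prod_univ_succ]
            simp only [Fin.cons_zero, Fin.cons_succ]
            congr 1
            ring
          · have hnmem : (Fin.cons x s : Fin (k + 1) → ℝ) ∉ maynardSimplex (k + 1) := by
              rw [cons_mem_maynardSimplex_iff]
              rintro ⟨-, hx0, hx1⟩
              exact hx ⟨hx0, by linarith⟩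
            rw [Set.indicator_of_notMem hnmem, Set.indicator_of_notMem hx]
        simp_rw [hGx]
        rw [lintegral_fibre_dirichlet hS hK a (c 0)]
        congr 1
        ring
      · rw [Set.indicator_of_notMem hs]
        have hGx : ∀ x, G (e.symm (x, s)) = 0 := by
          intro x
          rw [he_apply, hG]
          refine Set.indicator_of_notMem ?_ _
          rw [cons_mem_maynardSimplex_iff]
          exact fun h => hs h.1
        simp_rw [hGx]
        exact lintegral_zero
    -- Tonelli
    calc ∫⁻ t, G t = ∫⁻ p, G (e.symm p) := (he.lintegral_comp_emb e.symm.measurableEmbedding G).symm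
      _ = ∫⁻ s, ∫⁻ x, G (e.symm (x, s)) := by
          rw [Measure.volume_eq_prod]
          exact lintegral_prod_symm _ (hGm.comp e.symm.measurable).aemeasurable
      _ = ∫⁻ s, (maynardSimplex k).indicator (fun s => ENNReal.ofReal
            (B * ((1 - ∑ i, s i) ^ (a + c 0 + 1) * ∏ i, s i ^ c (Fin.succ i)))) s :=
          lintegral_congr hfibre
      _ = ∫⁻ s, ENNReal.ofReal B * (maynardSimplex k).indicator (fun s => ENNReal.ofReal
            (((1 - ∑ i, s i) ^ (a + c 0 + 1) * ∏ i, s i ^ c (Fin.succ i)))) s := by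
          refine lintegral_congr fun s => ?_
          by_cases hs : s ∈ maynardSimplex k
          · rw [Set.indicator_of_mem hs, Set.indicator_of_mem hs, ENNReal.ofReal_mul hB0]
          · rw [Set.indicator_of_notMem hs, Set.indicator_of_notMem hs, mul_zero]
      _ = ENNReal.ofReal B * ENNReal.ofReal ((((a + c 0 + 1)! : ℕ) * ∏ i, ((c (Fin.succ i))! : ℝ)) /
            (k + (a + c 0 + 1) + ∑ i, c (Fin.succ i))!) := by
          rw [lintegral_const_mul _ ?_, ih (a + c 0 + 1) fun i => c (Fin.succ i)]
          refine Measurable.indicator ?_ (measurableSet_maynardSimplex _)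
          exact (Continuous.measurable (by fun_prop)).ennreal_ofReal
      _ = ENNReal.ofReal ((a ! * ∏ i, ((c i)! : ℝ)) / ((k + 1 : ℕ) + a + ∑ i, c i)!) := by
          rw [← ENNReal.ofReal_mul hB0, hB, Fin.prod_univ_succ, Fin.sum_univ_succ,
            show k + (a + c 0 + 1) + ∑ i : Fin k, c (Fin.succ i) =
              (k + 1 : ℕ) + a + (c 0 + ∑ i : Fin k, c (Fin.succ i)) by ring,
            show c 0 + a + 1 = a + c 0 + 1 by ring]
          congr 1
          have h1 : (((a + c 0 + 1)! : ℕ) : ℝ) ≠ 0 := by positivity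
          field_simp

/-- **Dirichlet's integral over the simplex** (Maynard 2015, proof of Lemma 7.1, (7.4)):
`∫_{R_k} (1 − ∑ᵢ tᵢ)^a ∏ᵢ tᵢ^{cᵢ} dt = a! ∏ᵢ cᵢ! / (k + a + ∑ᵢ cᵢ)!`.
[cite: MaynardAnnals2015, Lemma 7.1, display (7.4)] -/
theorem setIntegral_simplex_dirichlet (k a : ℕ) (c : Fin k → ℕ) :
    ∫ t in maynardSimplex k, (1 - ∑ i, t i) ^ a * ∏ i, t i ^ c i =
      (a ! * ∏ i, ((c i)! : ℝ)) / (k + a + ∑ i, c i)! := by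
  have hnn : 0 ≤ᵐ[volume.restrict (maynardSimplex k)]
      fun t : Fin k → ℝ => (1 - ∑ i, t i) ^ a * ∏ i, t i ^ c i :=
    ae_restrict_of_forall_mem (measurableSet_maynardSimplex k)
      fun t ht => dirichlet_integrand_nonneg a c ht
  have hm : AEStronglyMeasurable (fun t : Fin k → ℝ => (1 - ∑ i, t i) ^ a * ∏ i, t i ^ c i)
      (volume.restrict (maynardSimplex k)) :=
    (Continuous.measurable (by fun_prop)).aestronglyMeasurable
  rw [integral_eq_lintegral_of_nonneg_ae hnn hm, ← lintegral_indicator (measurableSet_maynardSimplex k),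
    lintegral_simplex_dirichlet, ENNReal.toReal_ofReal]
  positivity

/-! ### The moments of `P₂ = ∑ tᵢ²` against `(1 − P₁)^a` (Maynard 2015, Lemma 7.1 with `j = 2`, `b ≤ 2`) -/

/-- `∏ᵢ tᵢ^{[i = j] n} = t_j^n`. [folklore] -/
theorem prod_pow_ite_eq {k : ℕ} (t : Fin k → ℝ) (j : Fin k) (n : ℕ) :
    ∏ i, t i ^ (if i = j then n else 0) = t j ^ n := by
  rw [Finset.prod_eq_single j (fun i _ hi => by simp [hi]) (fun h => absurd (Finset.mem_univ j) h)]
  simp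

/-- **Maynard 2015, Lemma 7.1, `b = 0`**: `∫_{R_k} (1 − P₁)^a = a!/(k + a)!`.
[cite: MaynardAnnals2015, Lemma 7.1] -/
theorem setIntegral_simplex_oneSubPow (k a : ℕ) :
    ∫ t in maynardSimplex k, (1 - ∑ i, t i) ^ a = (a ! : ℝ) / (k + a)! := by
  have h := setIntegral_simplex_dirichlet k a (fun _ => 0)
  simp only [pow_zero, Finset.prod_const_one, mul_one, Nat.factorial_zero, Nat.cast_one,
    Finset.sum_const_zero, add_zero] at h
  exact h

/-- Dirichlet's formula with a single nonzero exponent: `∫_{R_k} (1 − P₁)^a t_j^n = a! n!/(k + a + n)!`.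
[cite: MaynardAnnals2015, Lemma 7.1, display (7.4)] -/
theorem setIntegral_simplex_oneSubPow_mul_pow (k a n : ℕ) (j : Fin k) :
    ∫ t in maynardSimplex k, (1 - ∑ i, t i) ^ a * t j ^ n = (a ! * n ! : ℝ) / (k + a + n)! := by
  have h := setIntegral_simplex_dirichlet k a (fun i => if i = j then n else 0)
  simp_rw [prod_pow_ite_eq] at h
  rw [h, Finset.prod_eq_single j (fun i _ hi => by simp [hi]) (fun h => absurd (Finset.mem_univ j) h),
    Finset.sum_ite_eq' Finset.univ j]
  simp

/-- Dirichlet's formula with two exponents `2` at distinct places: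
`∫_{R_k} (1 − P₁)^a t_j² t_l² = 4 · a!/(k + a + 4)!` for `j ≠ l`.
[cite: MaynardAnnals2015, Lemma 7.1, display (7.4)] -/
theorem setIntegral_simplex_oneSubPow_mul_sq_mul_sq {k : ℕ} (a : ℕ) {j l : Fin k} (hjl : j ≠ l) :
    ∫ t in maynardSimplex k, (1 - ∑ i, t i) ^ a * (t j ^ 2 * t l ^ 2) =
      (a ! * 4 : ℝ) / (k + a + 4)! := by
  have h := setIntegral_simplex_dirichlet k a
    (fun i => (if i = j then 2 else 0) + (if i = l then 2 else 0))
  have hprod : ∀ t : Fin k → ℝ,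
      ∏ i, t i ^ ((if i = j then 2 else 0) + (if i = l then 2 else 0)) = t j ^ 2 * t l ^ 2 := by
    intro t
    simp_rw [pow_add, Finset.prod_mul_distrib, prod_pow_ite_eq]
  simp_rw [hprod] at h
  rw [h]
  have hfac : ∏ i : Fin k, ((((if i = j then 2 else 0) + (if i = l then 2 else 0))! : ℕ) : ℝ) = 4 := by
    rw [Finset.prod_eq_mul j l hjl (fun i _ hi => by simp [hi.1, hi.2])
      (fun h => absurd (Finset.mem_univ j) h) (fun h => absurd (Finset.mem_univ l) h)]
    simp [hjl, hjl.symm]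
    norm_num
  have hsum : ∑ i : Fin k, ((if i = j then 2 else 0) + (if i = l then 2 else 0)) = 4 := by
    rw [Finset.sum_add_distrib, Finset.sum_ite_eq' Finset.univ j, Finset.sum_ite_eq' Finset.univ l]
    simp
  rw [hfac, hsum]

/-- **Maynard 2015, Lemma 7.1, `j = 2`, `b = 1`**: `∫_{R_k} (1 − P₁)^a P₂ = 2k · a!/(k + a + 2)!`
(`G_{1,2}(k) = 2k`). [cite: MaynardAnnals2015, Lemma 7.1] -/
theorem setIntegral_simplex_oneSubPow_mul_powSumTwo (k a : ℕ) :
    ∫ t in maynardSimplex k, (1 - ∑ i, t i) ^ a * ∑ i, t i ^ 2 =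
      (2 * k * a ! : ℝ) / (k + a + 2)! := by
  have hint : ∀ j : Fin k, IntegrableOn
      (fun t : Fin k → ℝ => (1 - ∑ i, t i) ^ a * t j ^ 2) (maynardSimplex k) := fun j =>
    (by fun_prop : Continuous fun t : Fin k → ℝ => (1 - ∑ i, t i) ^ a * t j ^ 2).continuousOn
      |>.integrableOn_compact (isCompact_maynardSimplex k)
  simp_rw [Finset.mul_sum]
  rw [integral_finsetSum _ fun j _ => hint j]
  simp_rw [setIntegral_simplex_oneSubPow_mul_pow]
  rw [Finset.sum_const, Finset.card_univ, Fintype.card_fin, nsmul_eq_mul, Nat.factorial_two]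
  push_cast
  ring

/-- **Maynard 2015, Lemma 7.1, `j = 2`, `b = 2`**:
`∫_{R_k} (1 − P₁)^a P₂² = (4k² + 20k) · a!/(k + a + 4)!` (`G_{2,2}(k) = 24k + 4k(k − 1)`).
[cite: MaynardAnnals2015, Lemma 7.1] -/
theorem setIntegral_simplex_oneSubPow_mul_powSumTwo_sq (k a : ℕ) :
    ∫ t in maynardSimplex k, (1 - ∑ i, t i) ^ a * (∑ i, t i ^ 2) ^ 2 =
      ((4 * k ^ 2 + 20 * k) * a ! : ℝ) / (k + a + 4)! := by
  have hint : ∀ j l : Fin k, IntegrableOn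
      (fun t : Fin k → ℝ => (1 - ∑ i, t i) ^ a * (t j ^ 2 * t l ^ 2)) (maynardSimplex k) :=
    fun j l => (by fun_prop : Continuous fun t : Fin k → ℝ =>
      (1 - ∑ i, t i) ^ a * (t j ^ 2 * t l ^ 2)).continuousOn.integrableOn_compact
        (isCompact_maynardSimplex k)
  have hexp : ∀ t : Fin k → ℝ, (1 - ∑ i, t i) ^ a * (∑ i, t i ^ 2) ^ 2 =
      ∑ j, ∑ l, (1 - ∑ i, t i) ^ a * (t j ^ 2 * t l ^ 2) := by
    intro t
    rw [sq (∑ i, t i ^ 2), Finset.sum_mul_sum, Finset.mul_sum]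
    refine Finset.sum_congr rfl fun j _ => ?_
    rw [Finset.mul_sum]
  simp_rw [hexp]
  rw [integral_finsetSum _ fun j _ => integrable_finsetSum _ fun l _ => hint j l]
  have hinner : ∀ j : Fin k, ∫ t in maynardSimplex k, ∑ l, (1 - ∑ i, t i) ^ a * (t j ^ 2 * t l ^ 2) =
      (a ! * 24 : ℝ) / (k + a + 4)! + ((k : ℝ) - 1) * ((a ! * 4 : ℝ) / (k + a + 4)!) := by
    intro j
    rw [integral_finsetSum _ fun l _ => hint j l]
    have hterm : ∀ l : Fin k, ∫ t in maynardSimplex k, (1 - ∑ i, t i) ^ a * (t j ^ 2 * t l ^ 2) =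
        (a ! * 4 : ℝ) / (k + a + 4)! +
          (if l = j then (a ! * 24 : ℝ) / (k + a + 4)! - (a ! * 4 : ℝ) / (k + a + 4)! else 0) := by
      intro l
      by_cases hlj : l = j
      · subst hlj
        rw [if_pos rfl]
        simp_rw [← pow_add]
        rw [setIntegral_simplex_oneSubPow_mul_pow]
        norm_num [Nat.factorial]
      · rw [if_neg hlj, setIntegral_simplex_oneSubPow_mul_sq_mul_sq a (Ne.symm hlj)]
        ring
    simp_rw [hterm]
    rw [Finset.sum_add_distrib, Finset.sum_ite_eq' Finset.univ j, Finset.sum_const, Finset.card_univ,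
      Fintype.card_fin, nsmul_eq_mul]
    simp only [Finset.mem_univ, if_true]
    ring
  simp_rw [hinner]
  rw [Finset.sum_const, Finset.card_univ, Fintype.card_fin, nsmul_eq_mul]
  ring

end MaynardTao

end Literature.NumberTheory.Sieve
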